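import Mathlib.Analysis.Complex.TaylorSeries
import Mathlib.Analysis.Complex.Liouville
import Mathlib.Analysis.Calculus.MeanValue
import HarnessLib

/-!
# Cauchy estimates and Taylor remainders on a ball from a sup bound

Analysis/Complex support file (everything proved; no definitions, no named facts). For `f`
holomorphic on the open ball `ball c R ⊆ ℂ` with `‖f‖ ≤ M` there (values in a complete complex
normed space), the classical consequences of Cauchy's inequalities on the circle of radius `R/2`:

* `norm_iteratedDeriv_le_of_forall_mem_ball` — `‖f⁽ⁿ⁾(c)‖ ≤ n! M / (R/2)ⁿ`; in particular
  `‖f'(c)‖ ≤ 2M/R` and `‖f''(c)‖ ≤ 8M/R²` (`norm_deriv_le_of_forall_mem_ball`,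
  `norm_iteratedDeriv_two_le_of_forall_mem_ball`);
* `norm_sub_taylor_le_of_forall_mem_ball` — the Taylor remainder of order `N` at `c`:
  `‖f z − Σ_{n<N} (n!)⁻¹ (z−c)ⁿ f⁽ⁿ⁾(c)‖ ≤ 2M (2‖z − c‖/R)^N` for `‖z − c‖ ≤ R/4` (geometric tail
  of the Taylor series, `Complex.hasSum_taylorSeries_on_ball`), spelled out for `N = 1, 2, 3`
  (`norm_sub_le_…`, `norm_sub_sub_le_…`, `norm_sub_taylor_two_le_…`);
* `norm_sub_le_mul_of_forall_mem_ball` — the Lipschitz bound `‖f z − f w‖ ≤ (4M/R) ‖z − w‖` on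
  `ball c (R/2)` (mean value inequality with the Cauchy bound for `f'` on `ball c (R/2)`).

These are the estimates by which one-step expansions of functionals of a holomorphic map are
controlled by a single sup bound (consumer: the one-sided restriction martingale of
Lawler–Schramm–Werner (2003), Lemma 8.9, `Literature/Probability/RandomPlanarGeometry`).
Everything is tagged folklore (Cauchy's inequalities; e.g. Hörmander (1973), Thm. 2.2.7).
-/

noncomputable section

open Set Filter Metric Complex
open scoped Topology Nat

namespace Literature.Analysis.Complex

variable {F : Type*} [NormedAddCommGroup F] [NormedSpace ℂ F] [CompleteSpace F]
  {f : ℂ → F} {c : ℂ} {R M : ℝ}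

/-- **Cauchy's inequality from a sup bound on a ball**: `‖f⁽ⁿ⁾(c)‖ ≤ n! M / (R/2)ⁿ` for `f`
holomorphic on `ball c R` with `‖f‖ ≤ M` there. [folklore] -/
theorem norm_iteratedDeriv_le_of_forall_mem_ball (hR : 0 < R) (hf : DifferentiableOn ℂ f (ball c R))
    (hM : ∀ z ∈ ball c R, ‖f z‖ ≤ M) (n : ℕ) :
    ‖iteratedDeriv n f c‖ ≤ n ! * M / (R / 2) ^ n := by
  have hR2 : 0 < R / 2 := by positivity
  have hsub : closedBall c (R / 2) ⊆ ball c R := closedBall_subset_ball (by linarith)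
  have hdc : DiffContOnCl ℂ f (ball c (R / 2)) :=
    ⟨hf.mono (ball_subset_ball (by linarith)),
      (hf.mono (closure_ball_subset_closedBall.trans hsub)).continuousOn⟩
  exact Complex.norm_iteratedDeriv_le_of_forall_mem_sphere_norm_le n hR2 hdc
    fun z hz ↦ hM z (hsub (sphere_subset_closedBall hz))

/-- `‖f'(c)‖ ≤ 2M/R`. [folklore] -/
theorem norm_deriv_le_of_forall_mem_ball (hR : 0 < R) (hf : DifferentiableOn ℂ f (ball c R))
    (hM : ∀ z ∈ ball c R, ‖f z‖ ≤ M) : ‖deriv f c‖ ≤ 2 * M / R := by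
  have h := norm_iteratedDeriv_le_of_forall_mem_ball hR hf hM 1
  rw [iteratedDeriv_one] at h
  refine h.trans (le_of_eq ?_)
  simp only [Nat.factorial_one, Nat.cast_one, one_mul, pow_one]
  field_simp

/-- `‖f''(c)‖ ≤ 8M/R²`. [folklore] -/
theorem norm_iteratedDeriv_two_le_of_forall_mem_ball (hR : 0 < R) (hf : DifferentiableOn ℂ f (ball c R))
    (hM : ∀ z ∈ ball c R, ‖f z‖ ≤ M) : ‖iteratedDeriv 2 f c‖ ≤ 8 * M / R ^ 2 := by
  have h := norm_iteratedDeriv_le_of_forall_mem_ball hR hf hM 2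
  refine h.trans (le_of_eq ?_)
  simp only [Nat.factorial_two, Nat.cast_ofNat]
  field_simp
  ring

omit [NormedSpace ℂ F] [CompleteSpace F] in
/-- The sup bound is non-negative as soon as the ball is nonempty. [folklore] -/
theorem nonneg_of_forall_mem_ball_norm_le (hR : 0 < R) (hM : ∀ z ∈ ball c R, ‖f z‖ ≤ M) : 0 ≤ M :=
  (norm_nonneg _).trans (hM c (mem_ball_self hR))

/-- **Taylor remainder of order `N` from a sup bound**: for `‖z − c‖ ≤ R/4`,
`‖f z − Σ_{n<N} (n!)⁻¹ (z−c)ⁿ • f⁽ⁿ⁾(c)‖ ≤ 2M (2‖z−c‖/R)^N` (the tail of the Taylor series is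
dominated by the geometric series of ratio `2‖z − c‖/R ≤ 1/2`). [folklore] -/
theorem norm_sub_taylor_le_of_forall_mem_ball (hR : 0 < R) (hf : DifferentiableOn ℂ f (ball c R))
    (hM : ∀ z ∈ ball c R, ‖f z‖ ≤ M) {z : ℂ} (hz : ‖z - c‖ ≤ R / 4) (N : ℕ) :
    ‖f z - ∑ n ∈ Finset.range N, (n ! : ℂ)⁻¹ • (z - c) ^ n • iteratedDeriv n f c‖ ≤
      2 * M * (2 * ‖z - c‖ / R) ^ N := by
  have hM0 : 0 ≤ M := nonneg_of_forall_mem_ball_norm_le hR hM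
  have hqeq : 2 * ‖z - c‖ / R = ‖z - c‖ / (R / 2) := by field_simp
  rw [hqeq]
  set q : ℝ := ‖z - c‖ / (R / 2) with hq
  have hq0 : 0 ≤ q := by positivity
  have hq1 : q ≤ 1 / 2 := by
    rw [hq, div_le_iff₀ (by positivity)]; linarith
  have hzball : z ∈ ball c R := by
    rw [mem_ball, dist_eq_norm]; linarith
  -- the Taylor series and the bound on its terms
  set a : ℕ → F := fun n ↦ (n ! : ℂ)⁻¹ • (z - c) ^ n • iteratedDeriv n f c with ha
  have hsum : HasSum a (f z) := Complex.hasSum_taylorSeries_on_ball hf hzball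
  have han : ∀ n, ‖a n‖ ≤ M * q ^ n := fun n ↦ by
    have hfac : (0 : ℝ) < n ! := by exact_mod_cast Nat.factorial_pos n
    rw [ha]
    simp only [norm_smul, norm_inv, Complex.norm_natCast, norm_pow]
    calc (n ! : ℝ)⁻¹ * (‖z - c‖ ^ n * ‖iteratedDeriv n f c‖)
        ≤ (n ! : ℝ)⁻¹ * (‖z - c‖ ^ n * (n ! * M / (R / 2) ^ n)) := by
          gcongr
          exact norm_iteratedDeriv_le_of_forall_mem_ball hR hf hM n
      _ = M * q ^ n := by
          rw [hq]
          have hf0 : (n ! : ℝ) ≠ 0 := by positivity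
          calc (n ! : ℝ)⁻¹ * (‖z - c‖ ^ n * (n ! * M / (R / 2) ^ n))
              = ((n ! : ℝ)⁻¹ * n !) * (M * (‖z - c‖ ^ n / (R / 2) ^ n)) := by ring
            _ = M * (‖z - c‖ ^ n / (R / 2) ^ n) := by rw [inv_mul_cancel₀ hf0, one_mul]
            _ = M * (‖z - c‖ / (R / 2)) ^ n := by rw [← div_pow]
  -- the tail
  have htail : HasSum (fun n ↦ a (n + N)) (f z - ∑ n ∈ Finset.range N, a n) :=
    (hasSum_nat_add_iff' N).2 hsum
  have hgeo : HasSum (fun n : ℕ ↦ M * q ^ N * q ^ n) (M * q ^ N * (1 - q)⁻¹) :=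
    (hasSum_geometric_of_lt_one hq0 (by linarith)).mul_left _
  have hle : ‖f z - ∑ n ∈ Finset.range N, a n‖ ≤ M * q ^ N * (1 - q)⁻¹ := by
    refine htail.norm_le_of_bounded hgeo fun n ↦ ?_
    calc ‖a (n + N)‖ ≤ M * q ^ (n + N) := han _
      _ = M * q ^ N * q ^ n := by ring
  calc ‖f z - ∑ n ∈ Finset.range N, a n‖ ≤ M * q ^ N * (1 - q)⁻¹ := hle
    _ ≤ M * q ^ N * 2 := by
        gcongr
        rw [inv_le_comm₀ (by linarith) (by norm_num)]
        linarith
    _ = 2 * M * q ^ N := by ring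

/-- Order `1`: `‖f z − f c‖ ≤ 4M‖z − c‖/R` for `‖z − c‖ ≤ R/4`. [folklore] -/
theorem norm_sub_le_of_forall_mem_ball (hR : 0 < R) (hf : DifferentiableOn ℂ f (ball c R))
    (hM : ∀ z ∈ ball c R, ‖f z‖ ≤ M) {z : ℂ} (hz : ‖z - c‖ ≤ R / 4) :
    ‖f z - f c‖ ≤ 4 * M * ‖z - c‖ / R := by
  have h := norm_sub_taylor_le_of_forall_mem_ball hR hf hM hz 1
  simp only [Finset.range_one, Finset.sum_singleton, Nat.factorial_zero, Nat.cast_one, inv_one,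
    pow_zero, one_smul, iteratedDeriv_zero, pow_one] at h
  refine h.trans (le_of_eq ?_)
  ring

/-- Order `2`: `‖f z − f c − (z − c) • f'(c)‖ ≤ 8M‖z − c‖²/R²` for `‖z − c‖ ≤ R/4`. [folklore] -/
theorem norm_sub_sub_le_of_forall_mem_ball (hR : 0 < R) (hf : DifferentiableOn ℂ f (ball c R))
    (hM : ∀ z ∈ ball c R, ‖f z‖ ≤ M) {z : ℂ} (hz : ‖z - c‖ ≤ R / 4) :
    ‖f z - f c - (z - c) • deriv f c‖ ≤ 8 * M * ‖z - c‖ ^ 2 / R ^ 2 := by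
  have h := norm_sub_taylor_le_of_forall_mem_ball hR hf hM hz 2
  simp only [Finset.sum_range_succ, Finset.range_one, Finset.sum_singleton, Nat.factorial_zero,
    Nat.cast_one, inv_one, pow_zero, one_smul, iteratedDeriv_zero, Nat.factorial_one, pow_one,
    iteratedDeriv_one] at h
  rw [← sub_sub] at h
  refine h.trans (le_of_eq ?_)
  ring

/-- Order `3`: `‖f z − f c − (z − c) • f'(c) − ½ (z − c)² • f''(c)‖ ≤ 16M‖z − c‖³/R³` for
`‖z − c‖ ≤ R/4`. [folklore] -/
theorem norm_sub_taylor_two_le_of_forall_mem_ball (hR : 0 < R) (hf : DifferentiableOn ℂ f (ball c R))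
    (hM : ∀ z ∈ ball c R, ‖f z‖ ≤ M) {z : ℂ} (hz : ‖z - c‖ ≤ R / 4) :
    ‖f z - f c - (z - c) • deriv f c - ((2 : ℂ)⁻¹ * (z - c) ^ 2) • iteratedDeriv 2 f c‖ ≤
      16 * M * ‖z - c‖ ^ 3 / R ^ 3 := by
  have h := norm_sub_taylor_le_of_forall_mem_ball hR hf hM hz 3
  simp only [Finset.sum_range_succ, Finset.range_one, Finset.sum_singleton, Nat.factorial_zero,
    Nat.cast_one, inv_one, pow_zero, one_smul, iteratedDeriv_zero, Nat.factorial_one, pow_one,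
    iteratedDeriv_one, Nat.factorial_two, Nat.cast_ofNat] at h
  have heq : f z - f c - (z - c) • deriv f c - ((2 : ℂ)⁻¹ * (z - c) ^ 2) • iteratedDeriv 2 f c =
      f z - (f c + (z - c) • deriv f c + (2 : ℂ)⁻¹ • (z - c) ^ 2 • iteratedDeriv 2 f c) := by
    rw [smul_smul]; abel
  rw [heq]
  refine h.trans (le_of_eq ?_)
  ring

/-- **Lipschitz bound from a sup bound**: `‖f z − f w‖ ≤ (4M/R)‖z − w‖` for `z, w ∈ ball c (R/2)`
(every point of `ball c (R/2)` is the centre of a ball of radius `R/2` inside `ball c R`, so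
`‖f'‖ ≤ 4M/R` there; then the mean value inequality on the convex ball). [folklore] -/
theorem norm_sub_le_mul_of_forall_mem_ball (hR : 0 < R) (hf : DifferentiableOn ℂ f (ball c R))
    (hM : ∀ z ∈ ball c R, ‖f z‖ ≤ M) {z w : ℂ} (hz : z ∈ ball c (R / 2)) (hw : w ∈ ball c (R / 2)) :
    ‖f z - f w‖ ≤ 4 * M / R * ‖z - w‖ := by
  have hderiv : ∀ y ∈ ball c (R / 2), ‖deriv f y‖ ≤ 4 * M / R := by
    intro y hy
    have hsub : ball y (R / 2) ⊆ ball c R := by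
      intro u hu
      rw [mem_ball] at hu hy ⊢
      linarith [dist_triangle u y c]
    have h := norm_deriv_le_of_forall_mem_ball (c := y) (by positivity : 0 < R / 2) (hf.mono hsub)
      fun u hu ↦ hM u (hsub hu)
    refine h.trans (le_of_eq ?_)
    field_simp
    ring
  have hdiff : ∀ y ∈ ball c (R / 2), DifferentiableAt ℂ f y := fun y hy ↦
    hf.differentiableAt (isOpen_ball.mem_nhds (ball_subset_ball (by linarith) hy))
  exact (convex_ball c (R / 2)).norm_image_sub_le_of_norm_deriv_le hdiff hderiv hw hz

end Literature.Analysis.Complex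

end
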